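import Mathlib.Algebra.Polynomial.AlgebraMap
import Mathlib.LinearAlgebra.FiniteDimensional.Basic
import HarnessLib

/-!
# Eigenvalue-separating annihilators («quasi-projectors»)

Elementary linear algebra, sorry-free. Setting: `K` a field, `V` a `K`-vector space, `T : Module.End K V`,
and a `T`-stable decomposition `V = V₁ ⊕ V₂` (`IsCompl V₁ V₂`, `T V₁ ⊆ V₁`). If a polynomial `p` satisfies
`p(T) = 0` on `V₂` and `p(T)` is injective on `V₁`, then `Θ := p(T)` is a «quasi-projector onto `V₁`»:

* `range_aeval_le_of_isCompl` — `Θ V ⊆ V₁`;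
* `ker_aeval_eq_of_isCompl` — `ker Θ = V₂`;
* `aeval_restrict_bijective` — `Θ|_{V₁}` is bijective when `V₁` is finite-dimensional;

together with the bookkeeping used to BUILD such a `p` from linear factors:

* `aeval_apply_mem` — a `T`-stable submodule is `p(T)`-stable;
* `aeval_mul_injOn`, `aeval_pow_injOn`, `aeval_prod_injOn` — injectivity on a `T`-stable submodule is
  multiplicative in `p`;
* `aeval_X_sub_C_apply`, `aeval_X_sub_C_injOn_iff` — the linear factor `X - C a` acts as `T - a` and is
  injective on `W` iff `a` is not an eigenvalue of `T` on `W`;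
* `aeval_mul_apply_eq_zero` — if `q(T) v = 0` then `(r * q)(T) v = 0` (so `(X - C a) ^ n` kills every
  vector killed by a lower power: no semisimplicity is needed to annihilate a generalized eigenspace).

Typical instance (the one this file was written for; nothing below depends on it): `V = M ⊗ Frac(Λ)` for a
Hecke module `M` over an Iwasawa algebra `Λ`, `T = T_ℓ` a Hecke operator, `V₂` = the Eisenstein part (on which
`T_ℓ` has eigenvalues in a finite set `𝒜`), `V₁` = the cuspidal part (on which no `a ∈ 𝒜` is an eigenvalue, by the
Ramanujan–Petersson bound against `|η₁(ℓ) + η₂(ℓ)ℓ^{k+1}|`), `p = ∏_{a ∈ 𝒜} (X - a)^n`: then `p(T_ℓ)` maps all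
forms to cusp forms and is invertible on cusp forms — an integral substitute for the cuspidal idempotent, used in
`pub/bsd-litref/cgs25/sheets/D-AUDIT-cgs25-r2-ADDENDUM-9.md` §2 (sha16 2fb9c8cd650df85a). The file is pure
linear algebra; each declaration carries the [cite:] locator of the printed proof step it serves (KLZ17 §9.5), as the lint requires, and states only elementary facts.
-/

namespace Literature.LinearAlgebra

open Polynomial Function

section QuasiProjector

variable {K : Type*} [Field K] {V : Type*} [AddCommGroup V] [Module K V]

/-- Powers of `T` preserve a `T`-stable submodule. [cite: KingsLoefflerZerbes2015, §9.5, proof of Thm 9.5.2 («Since both maps are Hecke-equivariant … they agree on the subspace spanned by the image … under all Hecke operators … contains all ordinary cusp forms», arXiv v3 p. 84) — module-theoretic step «quasi-projector Θ», §2 (i)–(iii), of the in-cell reader assembly L-η (D-AUDIT-cgs25-r2-ADDENDUM-9) only; the statement below is the elementary linear algebra that step uses, not a theorem printed in the source] -/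
theorem pow_apply_mem (T : Module.End K V) (W : Submodule K V) (hW : ∀ v ∈ W, T v ∈ W) (n : ℕ) :
    ∀ v ∈ W, (T ^ n) v ∈ W := by
  induction n with
  | zero => intro v hv; simpa using hv
  | succ n ih =>
    intro v hv
    rw [pow_succ, Module.End.mul_apply]
    exact ih _ (hW v hv)

/-- A `T`-stable submodule is stable under every polynomial in `T`. [cite: KingsLoefflerZerbes2015, §9.5, proof of Thm 9.5.2 («Since both maps are Hecke-equivariant … they agree on the subspace spanned by the image … under all Hecke operators … contains all ordinary cusp forms», arXiv v3 p. 84) — module-theoretic step «quasi-projector Θ», §2 (i)–(iii), of the in-cell reader assembly L-η (D-AUDIT-cgs25-r2-ADDENDUM-9) only; the statement below is the elementary linear algebra that step uses, not a theorem printed in the source] -/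
theorem aeval_apply_mem (T : Module.End K V) (W : Submodule K V) (hW : ∀ v ∈ W, T v ∈ W) (p : K[X]) :
    ∀ v ∈ W, aeval T p v ∈ W := by
  intro v hv
  induction p using Polynomial.induction_on' with
  | add p q hp hq =>
    rw [map_add, LinearMap.add_apply]
    exact W.add_mem hp hq
  | monomial n a =>
    rw [aeval_monomial, Module.End.mul_apply, Module.algebraMap_end_apply]
    exact W.smul_mem a (pow_apply_mem T W hW n v hv)

/-- If `p(T)` vanishes on `V₂` and `V = V₁ ⊕ V₂` with `V₁` stable under `T`, then `p(T)` maps `V` into `V₁`.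
[cite: KingsLoefflerZerbes2015, §9.5, proof of Thm 9.5.2 («Since both maps are Hecke-equivariant … they agree on the subspace spanned by the image … under all Hecke operators … contains all ordinary cusp forms», arXiv v3 p. 84) — module-theoretic step «quasi-projector Θ», §2 (i)–(iii), of the in-cell reader assembly L-η (D-AUDIT-cgs25-r2-ADDENDUM-9) only; the statement below is the elementary linear algebra that step uses, not a theorem printed in the source] -/
theorem range_aeval_le_of_isCompl (T : Module.End K V) (p : K[X]) {V₁ V₂ : Submodule K V}
    (hc : IsCompl V₁ V₂) (h₁ : ∀ v ∈ V₁, T v ∈ V₁) (h₂ : ∀ v ∈ V₂, aeval T p v = 0) :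
    LinearMap.range (aeval T p) ≤ V₁ := by
  rintro _ ⟨v, rfl⟩
  have hv : v ∈ V₁ ⊔ V₂ := by
    rw [hc.sup_eq_top]
    exact Submodule.mem_top
  obtain ⟨v₁, hv₁, v₂, hv₂, rfl⟩ := Submodule.mem_sup.mp hv
  rw [map_add, h₂ v₂ hv₂, add_zero]
  exact aeval_apply_mem T V₁ h₁ p v₁ hv₁

/-- Pointwise form of `range_aeval_le_of_isCompl`. [cite: KingsLoefflerZerbes2015, §9.5, proof of Thm 9.5.2 («Since both maps are Hecke-equivariant … they agree on the subspace spanned by the image … under all Hecke operators … contains all ordinary cusp forms», arXiv v3 p. 84) — module-theoretic step «quasi-projector Θ», §2 (i)–(iii), of the in-cell reader assembly L-η (D-AUDIT-cgs25-r2-ADDENDUM-9) only; the statement below is the elementary linear algebra that step uses, not a theorem printed in the source] -/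
theorem aeval_apply_mem_of_isCompl (T : Module.End K V) (p : K[X]) {V₁ V₂ : Submodule K V}
    (hc : IsCompl V₁ V₂) (h₁ : ∀ v ∈ V₁, T v ∈ V₁) (h₂ : ∀ v ∈ V₂, aeval T p v = 0) (v : V) :
    aeval T p v ∈ V₁ :=
  range_aeval_le_of_isCompl T p hc h₁ h₂ ⟨v, rfl⟩

/-- If moreover `p(T)` is injective on `V₁`, then `ker p(T) = V₂` exactly. [cite: KingsLoefflerZerbes2015, §9.5, proof of Thm 9.5.2 («Since both maps are Hecke-equivariant … they agree on the subspace spanned by the image … under all Hecke operators … contains all ordinary cusp forms», arXiv v3 p. 84) — module-theoretic step «quasi-projector Θ», §2 (i)–(iii), of the in-cell reader assembly L-η (D-AUDIT-cgs25-r2-ADDENDUM-9) only; the statement below is the elementary linear algebra that step uses, not a theorem printed in the source] -/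
theorem ker_aeval_eq_of_isCompl (T : Module.End K V) (p : K[X]) {V₁ V₂ : Submodule K V}
    (hc : IsCompl V₁ V₂) (h₂ : ∀ v ∈ V₂, aeval T p v = 0)
    (hinj : ∀ v ∈ V₁, aeval T p v = 0 → v = 0) :
    LinearMap.ker (aeval T p) = V₂ := by
  apply le_antisymm
  · intro v hv
    rw [LinearMap.mem_ker] at hv
    have hv' : v ∈ V₁ ⊔ V₂ := by
      rw [hc.sup_eq_top]
      exact Submodule.mem_top
    obtain ⟨v₁, hv₁, v₂, hv₂, rfl⟩ := Submodule.mem_sup.mp hv'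
    rw [map_add, h₂ v₂ hv₂, add_zero] at hv
    rw [hinj v₁ hv₁ hv, zero_add]
    exact hv₂
  · intro v hv
    exact LinearMap.mem_ker.mpr (h₂ v hv)

/-- On a finite-dimensional `T`-stable `V₁` on which `p(T)` is injective, `p(T)` restricts to a bijection of `V₁`.
[cite: KingsLoefflerZerbes2015, §9.5, proof of Thm 9.5.2 («Since both maps are Hecke-equivariant … they agree on the subspace spanned by the image … under all Hecke operators … contains all ordinary cusp forms», arXiv v3 p. 84) — module-theoretic step «quasi-projector Θ», §2 (i)–(iii), of the in-cell reader assembly L-η (D-AUDIT-cgs25-r2-ADDENDUM-9) only; the statement below is the elementary linear algebra that step uses, not a theorem printed in the source] -/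
theorem aeval_restrict_bijective (T : Module.End K V) (p : K[X]) {V₁ : Submodule K V}
    [FiniteDimensional K V₁] (h₁ : ∀ v ∈ V₁, T v ∈ V₁)
    (hinj : ∀ v ∈ V₁, aeval T p v = 0 → v = 0) :
    Bijective ((aeval T p).restrict (aeval_apply_mem T V₁ h₁ p)) := by
  have hi : Injective ((aeval T p).restrict (aeval_apply_mem T V₁ h₁ p)) := by
    intro x y hxy
    apply Subtype.ext
    have h : aeval T p (x - y : V) = 0 := by
      have := congrArg Subtype.val hxy
      simp only [LinearMap.coe_restrict_apply] at this
      rw [map_sub, this, sub_self]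
    exact sub_eq_zero.mp (hinj _ (V₁.sub_mem x.2 y.2) h)
  exact ⟨hi, LinearMap.injective_iff_surjective.mp hi⟩

/-- If `q(T) v = 0` then `(r * q)(T) v = 0`. In particular `(X - C a) ^ n` kills every vector killed by
`(X - C a) ^ k`, `k ≤ n` (take `r = (X - C a) ^ (n - k)`): a generalized eigenspace of exponent `≤ n` is
annihilated without any semisimplicity. [cite: KingsLoefflerZerbes2015, §9.5, proof of Thm 9.5.2 («Since both maps are Hecke-equivariant … they agree on the subspace spanned by the image … under all Hecke operators … contains all ordinary cusp forms», arXiv v3 p. 84) — module-theoretic step «quasi-projector Θ», §2 (i)–(iii), of the in-cell reader assembly L-η (D-AUDIT-cgs25-r2-ADDENDUM-9) only; the statement below is the elementary linear algebra that step uses, not a theorem printed in the source] -/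
theorem aeval_mul_apply_eq_zero (T : Module.End K V) {q : K[X]} {v : V} (h : aeval T q v = 0) (r : K[X]) :
    aeval T (r * q) v = 0 := by
  rw [map_mul, Module.End.mul_apply, h, map_zero]

/-- Injectivity on a `T`-stable submodule is multiplicative in the polynomial. [cite: KingsLoefflerZerbes2015, §9.5, proof of Thm 9.5.2 («Since both maps are Hecke-equivariant … they agree on the subspace spanned by the image … under all Hecke operators … contains all ordinary cusp forms», arXiv v3 p. 84) — module-theoretic step «quasi-projector Θ», §2 (i)–(iii), of the in-cell reader assembly L-η (D-AUDIT-cgs25-r2-ADDENDUM-9) only; the statement below is the elementary linear algebra that step uses, not a theorem printed in the source] -/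
theorem aeval_mul_injOn (T : Module.End K V) (W : Submodule K V) (hW : ∀ v ∈ W, T v ∈ W) {p q : K[X]}
    (hp : ∀ v ∈ W, aeval T p v = 0 → v = 0) (hq : ∀ v ∈ W, aeval T q v = 0 → v = 0) :
    ∀ v ∈ W, aeval T (p * q) v = 0 → v = 0 := by
  intro v hv h
  rw [map_mul, Module.End.mul_apply] at h
  exact hq v hv (hp _ (aeval_apply_mem T W hW q v hv) h)

/-- Powers of a polynomial injective on a `T`-stable submodule stay injective there. [cite: KingsLoefflerZerbes2015, §9.5, proof of Thm 9.5.2 («Since both maps are Hecke-equivariant … they agree on the subspace spanned by the image … under all Hecke operators … contains all ordinary cusp forms», arXiv v3 p. 84) — module-theoretic step «quasi-projector Θ», §2 (i)–(iii), of the in-cell reader assembly L-η (D-AUDIT-cgs25-r2-ADDENDUM-9) only; the statement below is the elementary linear algebra that step uses, not a theorem printed in the source] -/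
theorem aeval_pow_injOn (T : Module.End K V) (W : Submodule K V) (hW : ∀ v ∈ W, T v ∈ W) {p : K[X]}
    (hp : ∀ v ∈ W, aeval T p v = 0 → v = 0) (n : ℕ) :
    ∀ v ∈ W, aeval T (p ^ n) v = 0 → v = 0 := by
  induction n with
  | zero =>
    intro v _ h
    simpa using h
  | succ n ih =>
    rw [pow_succ]
    exact aeval_mul_injOn T W hW ih hp

/-- A finite product of polynomials each injective on a `T`-stable submodule is injective there. [cite: KingsLoefflerZerbes2015, §9.5, proof of Thm 9.5.2 («Since both maps are Hecke-equivariant … they agree on the subspace spanned by the image … under all Hecke operators … contains all ordinary cusp forms», arXiv v3 p. 84) — module-theoretic step «quasi-projector Θ», §2 (i)–(iii), of the in-cell reader assembly L-η (D-AUDIT-cgs25-r2-ADDENDUM-9) only; the statement below is the elementary linear algebra that step uses, not a theorem printed in the source] -/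
theorem aeval_prod_injOn (T : Module.End K V) (W : Submodule K V) (hW : ∀ v ∈ W, T v ∈ W)
    {ι : Type*} (s : Finset ι) (f : ι → K[X])
    (hf : ∀ i ∈ s, ∀ v ∈ W, aeval T (f i) v = 0 → v = 0) :
    ∀ v ∈ W, aeval T (∏ i ∈ s, f i) v = 0 → v = 0 := by
  classical
  induction s using Finset.induction_on with
  | empty =>
    intro v _ h
    simpa using h
  | insert i s hi ih =>
    rw [Finset.prod_insert hi]
    exact aeval_mul_injOn T W hW (hf i (Finset.mem_insert_self i s))
      (ih fun j hj => hf j (Finset.mem_insert_of_mem hj))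

/-- The linear factor `X - C a` acts as `T - a`. [cite: KingsLoefflerZerbes2015, §9.5, proof of Thm 9.5.2 («Since both maps are Hecke-equivariant … they agree on the subspace spanned by the image … under all Hecke operators … contains all ordinary cusp forms», arXiv v3 p. 84) — module-theoretic step «quasi-projector Θ», §2 (i)–(iii), of the in-cell reader assembly L-η (D-AUDIT-cgs25-r2-ADDENDUM-9) only; the statement below is the elementary linear algebra that step uses, not a theorem printed in the source] -/
theorem aeval_X_sub_C_apply (T : Module.End K V) (a : K) (v : V) :
    aeval T (X - C a) v = T v - a • v := by
  rw [map_sub, aeval_X, aeval_C, LinearMap.sub_apply, Module.algebraMap_end_apply]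

/-- `X - C a` is injective on `W` iff `a` is not an eigenvalue of `T` on `W`. [cite: KingsLoefflerZerbes2015, §9.5, proof of Thm 9.5.2 («Since both maps are Hecke-equivariant … they agree on the subspace spanned by the image … under all Hecke operators … contains all ordinary cusp forms», arXiv v3 p. 84) — module-theoretic step «quasi-projector Θ», §2 (i)–(iii), of the in-cell reader assembly L-η (D-AUDIT-cgs25-r2-ADDENDUM-9) only; the statement below is the elementary linear algebra that step uses, not a theorem printed in the source] -/
theorem aeval_X_sub_C_injOn_iff (T : Module.End K V) (W : Submodule K V) (a : K) :
    (∀ v ∈ W, aeval T (X - C a) v = 0 → v = 0) ↔ ∀ v ∈ W, T v = a • v → v = 0 := by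
  constructor
  · intro h v hv hTv
    exact h v hv (by rw [aeval_X_sub_C_apply, hTv, sub_self])
  · intro h v hv h0
    rw [aeval_X_sub_C_apply, sub_eq_zero] at h0
    exact h v hv h0

/-- A polynomial vanishing on `V₂` that is a product `∏ (X - C (a i)) ^ n` over values `a i` none of which is an
eigenvalue of `T` on the `T`-stable complement `V₁` is a quasi-projector onto `V₁`: it maps `V` into `V₁`, its
kernel is `V₂`, and (if `V₁` is finite-dimensional) it is bijective on `V₁`. [cite: KingsLoefflerZerbes2015, §9.5, proof of Thm 9.5.2 («Since both maps are Hecke-equivariant … they agree on the subspace spanned by the image … under all Hecke operators … contains all ordinary cusp forms», arXiv v3 p. 84) — module-theoretic step «quasi-projector Θ», §2 (i)–(iii), of the in-cell reader assembly L-η (D-AUDIT-cgs25-r2-ADDENDUM-9) only; the statement below is the elementary linear algebra that step uses, not a theorem printed in the source] -/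
theorem quasiProjector_of_prod_linear_factors (T : Module.End K V) {V₁ V₂ : Submodule K V}
    (hc : IsCompl V₁ V₂) (h₁ : ∀ v ∈ V₁, T v ∈ V₁) {ι : Type*} (s : Finset ι) (a : ι → K) (n : ℕ)
    (hsep : ∀ i ∈ s, ∀ v ∈ V₁, T v = a i • v → v = 0)
    (h₂ : ∀ v ∈ V₂, aeval T (∏ i ∈ s, (X - C (a i)) ^ n) v = 0) :
    LinearMap.range (aeval T (∏ i ∈ s, (X - C (a i)) ^ n)) ≤ V₁ ∧
      LinearMap.ker (aeval T (∏ i ∈ s, (X - C (a i)) ^ n)) = V₂ ∧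
      ∀ v ∈ V₁, aeval T (∏ i ∈ s, (X - C (a i)) ^ n) v = 0 → v = 0 := by
  have hinj : ∀ v ∈ V₁, aeval T (∏ i ∈ s, (X - C (a i)) ^ n) v = 0 → v = 0 :=
    aeval_prod_injOn T V₁ h₁ s (fun i => (X - C (a i)) ^ n) fun i hi =>
      aeval_pow_injOn T V₁ h₁ ((aeval_X_sub_C_injOn_iff T V₁ (a i)).mpr (hsep i hi)) n
  exact ⟨range_aeval_le_of_isCompl T _ hc h₁ h₂, ker_aeval_eq_of_isCompl T _ hc h₂ hinj, hinj⟩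

end QuasiProjector

end Literature.LinearAlgebra
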